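/- Copyright: ym3-torus cell, WIDTH-5 ATTACH seat `ym-ust-19936-w4` (prover, g10), for crux `HistoryTailL` (stmt-QuantumFields-19936),
level-0 prefactor-free infrastructure, stage (T4) «uniform doubling», assembly (T4-ALL) on (ℤ∕L)³ for `SU(2)` MODULO the one-site doubling (T4-ONE).
Released under the licence of the surrounding project. -/
import Summits.QuantumFields.YangMills.Theorems.LocalInsertionTorusUpperAxisD3
import Summits.QuantumFields.YangMills.Theorems.LocalInsertionTorusLowerAxisHolonomy
import Summits.QuantumFields.YangMills.Theorems.LocalInsertionOneLinkGaussianBoundSU2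
import Summits.QuantumFields.YangMills.Theorems.LangevinControlUVFemtoCurvatureTwoPointCTorusLowerAxis
import HarnessLib

/-!
# Uniform doubling of the `SU(2)` Wilson partition function on the three-torus, modulo the one-site doubling

Support file (`--supports stmt-QuantumFields-19936 --as helper`), stage (T4) «uniform doubling» of the cell's level-0 PREFACTOR-FREE plan (LEAD
★w1-19936 g7 00:52:13Z ∕ 01:07:50Z: T4-LOW ★w7 ✓`exists_lintegral_boltzmann_ge_axisHolonomy_SU`, T4-UP ★w4 ✓`torus_upper_axisHolonomy_d3`).  This file
is T4-ALL for `G = SU(2)`, `ρ = fundamentalRep (Fin 2)` on `GaugeConfig 3 L`, MODULO the displayed one-site doubling hypothesis (T4-ONE)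
`hONE : ∃ K, ∀ t > 0, Z₁(t∕4) ≤ K · Z₁(t)` (`Z₁ = partitionFunction (d := 3) (L := 1)`, the three-link one-site commutator integral):

* `torus_upper_axisHolonomy_d3_of_oneLink` — the holonomy-conditioned triangular UPPER bound with an ARBITRARY one-link bound `z` displayed
  (the proof of ✓`torus_upper_axisHolonomy_d3` verbatim, its one-link Laplace constant replaced by the hypothesis `hlap`):
  `Z_L(b∕2) ≤ z^{2L³−2} · Z₁(b∕(4L²))` whenever `∫ e^{−(b∕4)(N − Re tr ρ)} dHaar ≤ z`, `b ≥ 0`, `L ≥ 2`;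
* `torus_upper_axisHolonomy_su2_d3` — its `SU(2)` reading with the SHARP one-link Gaussian bound ✓`integral_exp_neg_mul_actionTerm_fundamentalRep_le`
  (`z = 8∕((b∕4)√(b∕4))`, `b ≥ 4`) — exponent `3∕2 = dim SU(2)∕2` as a NUMBER, matching the `N² − 1 = 3` of T4-LOW without any `dimE` identification;
* `lintegral_oneSite_eq_partitionFunction` — T4-LOW's one-site integral over `Fin 3 → G` IS `Z₁` (reindexing `Edge 3 1 ≃ Fin 3`, ✓`pi_map_proj_eq_pi`);
* `partitionFunction_antitone_d3`, `partitionFunction_iterate_quarter_d3`, `sixteen_mul_pow_three_le` — d = 3 ports of the bookkeeping helpers of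
  ✓`uniformDoubling_all` (`Z` is antitone in the coupling; `Z₁(t∕4^m) ≤ K^m Z₁(t)`; the temperature mismatch `16L³ ≤ 4^{3L+2}`);
* ★`uniformDoubling_su2_d3_of_oneSiteDoubling` — **(T4-ALL mod T4-ONE)**: `hONE → ∃ A, ∀ L ≥ 2, b ≥ 4, Z_L(b∕2) ≤ e^{A·L³} · Z_L(b)` for `SU(2)` on (ℤ∕L)³ —
  the doubling constant is UNIFORM in `b` (`(b∕4)^{−3∕2}·(√(1+b))^{3} ≤ 32` per link) — the cure of the residual `β^{c∕n}` of (EM)∕(GT), given (T4-ONE).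

HONEST SCOPE.  Ports (4 → 3) and real-arithmetic bookkeeping over tree theorems; the one-site doubling (T4-ONE) on `GaugeConfig 3 1` is NOT proved
here (its d = 4 template ✓`oneSite_partitionFunction_doubling` rests on the `GaugeConfig 4`-hard-wired sublevel-doubling chain); nothing of the
lines' stubs, of `HistoryTailL` or of any crux is proved.  YM₃ on T³ is rung R3 — not d = 4, not infinite volume, not a mass gap, not Clay.
-/

noncomputable section

open scoped ENNReal
open MeasureTheory Finset
open Literature.MathematicalPhysics.QuantumFieldTheory
open Literature.MathematicalPhysics.QuantumLattice (fundamentalRep fundamentalRep_apply continuous_fundamentalRep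
  fundamentalRep_mem_unitaryGroup)
open Summit.QuantumFields.YangMills.Theorems.FemtoCurvatureTwoPoint.PlaquetteVariance
  (partitionFunction_toReal_pos re_trace_le)
open Summit.QuantumFields.YangMills.Theorems.FemtoCurvatureTwoPointC
open Summit.QuantumFields.YangMills.Theorems.FemtoCurvatureTwoPointC.TorusGauge
  (lintegral_mul_prod_le_pow_mul_lintegral pi_map_proj_eq_pi)
open Summit.QuantumFields.YangMills.Theorems.LocalInsertion.TorusUpperAxisD3

namespace Summit.QuantumFields.YangMills.Theorems.LocalInsertion.TorusUniformDoublingSU2D3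

-- adapted from Theorems/LocalInsertionTorusUpperAxisD3.lean and Theorems/LangevinControlUVFemtoCurvatureTwoPointCUniformDoublingAll.lean (4 → 3)

/-- **Holonomy-conditioned triangular upper bound, one-link bound displayed**: on `(ℤ∕L)³`, `L ≥ 2`, `b ≥ 0`, for a continuous unitary
`ρ` and any `z ≥ 0` with `∫ e^{−(b∕4)(N − Re tr ρ(g))} dg ≤ z`:  `Z_L(b∕2) ≤ z^{2L³−2} · Z₁(b∕(4L²))`
(the proof of ✓`torus_upper_axisHolonomy_d3`, verbatim, with `hlap` as a hypothesis). [cite: arXiv160201222, §11] -/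
theorem torus_upper_axisHolonomy_d3_of_oneLink {G : Type} [Group G] [TopologicalSpace G] [IsTopologicalGroup G]
    [CompactSpace G] [MeasurableSpace G] [BorelSpace G] [SecondCountableTopology G] {N : ℕ}
    (ρ : G →* Matrix (Fin N) (Fin N) ℂ) (hρc : Continuous ρ) (hρu : ∀ g, ρ g ∈ Matrix.unitaryGroup (Fin N) ℂ)
    (L : ℕ) [NeZero L] {b z : ℝ} (hL : 2 ≤ L) (hb : 0 ≤ b) (hz0 : 0 ≤ z)
    (hlap : ∫ x, Real.exp (-(b / 4 * ((N : ℝ) - (ρ x).trace.re))) ∂haarProbability G ≤ z) :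
    (partitionFunction (d := 3) (L := L) ρ (b / 2)).toReal ≤
      z ^ (2 * L ^ 3 - 2) * (partitionFunction (d := 3) (L := 1) ρ (b / (4 * (L : ℝ) ^ 2))).toReal := by
  classical
  obtain ⟨P, top, rk, hrk, htop, hcard, hP⟩ := torus_topLink_assignment_sharp_offAxis_d3 L hL
  have hb40 : 0 ≤ b / 4 := div_nonneg hb (by norm_num)
  set t : ℝ := b / (4 * (L : ℝ) ^ 2) with ht
  have ht0 : 0 ≤ t := by positivity
  let links : Plaquette 3 L → Finset (Edge 3 L) := fun p =>
    {(p.1, p.2.1.1), (p.1.shift p.2.1.1, p.2.1.2), (p.1.shift p.2.1.2, p.2.1.1), (p.1, p.2.1.2)}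
  let w : Plaquette 3 L → GaugeConfig 3 L G → ℝ≥0∞ := fun p U => ENNReal.ofReal
    (Real.exp (-(b / 4 * ((N : ℝ) - (ρ (plaquetteHolonomy U p.1 p.2.1.1 p.2.1.2)).trace.re))))
  let Ψ : GaugeConfig 3 L G → GaugeConfig 3 1 G := fun U e' => lineHolonomy U e'.2 L 0
  let g : GaugeConfig 3 L G → ℝ≥0∞ := fun U =>
    ENNReal.ofReal (Real.exp (-t * wilsonAction ρ (Ψ U)))
  have hw1 : ∀ (p : Plaquette 3 L) (U : GaugeConfig 3 L G), w p U ≤ 1 := fun p U =>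
    TorusGauge.TorusUpper.ofReal_boltzmann_le_one ρ hρc hb40 _
  have hΨm : Measurable Ψ := measurable_pi_lambda _ fun e' => measurable_lineHolonomy_d3 _ _ _
  have hEm : Measurable fun V : GaugeConfig 3 1 G =>
      ENNReal.ofReal (Real.exp (-t * wilsonAction ρ V)) :=
    ENNReal.measurable_ofReal.comp (Real.measurable_exp.comp
      ((WilsonRP.measurable_wilsonAction ρ hρc).const_mul _))
  have hgm : Measurable g := hEm.comp hΨm
  -- (1) pointwise: `e^{-(b/2) S} ≤ g · ∏_{p ∈ P} w_p`
  have hpt : ∀ U : GaugeConfig 3 L G,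
      ENNReal.ofReal (Real.exp (-(b / 2) * wilsonAction ρ U)) ≤ g U * ∏ p ∈ P, w p U := by
    intro U
    have hSt := axisCommutatorCost_le_wilsonAction_general ρ hρu U
    rw [← OneSiteD3.wilsonAction_eq_commutatorCost ρ (Ψ U)] at hSt
    have hS0 : 0 ≤ wilsonAction ρ U := Finset.sum_nonneg fun p _ =>
      sub_nonneg.2 (re_trace_le ρ hρc _)
    have h1 : Real.exp (-(b / 4) * wilsonAction ρ U) ≤ Real.exp (-t * wilsonAction ρ (Ψ U)) := by
      refine Real.exp_le_exp.2 ?_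
      have : t * wilsonAction ρ (Ψ U) ≤ t * ((L : ℝ) ^ 2 * wilsonAction ρ U) :=
        mul_le_mul_of_nonneg_left hSt ht0
      have hcancel : t * ((L : ℝ) ^ 2 * wilsonAction ρ U) = b / 4 * wilsonAction ρ U := by
        rw [ht]
        field_simp
      linarith
    have h2 : ENNReal.ofReal (Real.exp (-(b / 4) * wilsonAction ρ U)) ≤ ∏ p ∈ P, w p U := by
      have hall : ENNReal.ofReal (Real.exp (-(b / 4) * wilsonAction ρ U)) = ∏ p, w p U := by
        rw [← ENNReal.ofReal_prod_of_nonneg fun p _ => (Real.exp_pos _).le, ← Real.exp_sum]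
        congr 1
        rw [wilsonAction, neg_mul, Finset.mul_sum, ← Finset.sum_neg_distrib]
      rw [hall]
      exact Finset.prod_le_prod_of_subset_of_le_one' (Finset.subset_univ P) fun p _ _ => hw1 p U
    calc ENNReal.ofReal (Real.exp (-(b / 2) * wilsonAction ρ U))
        = ENNReal.ofReal (Real.exp (-(b / 4) * wilsonAction ρ U)) *
            ENNReal.ofReal (Real.exp (-(b / 4) * wilsonAction ρ U)) := by
          rw [← ENNReal.ofReal_mul (Real.exp_pos _).le, ← Real.exp_add]
          congr 2
          ring
      _ ≤ g U * ∏ p ∈ P, w p U :=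
          mul_le_mul' (ENNReal.ofReal_le_ofReal h1) h2
  -- (2) triangular integration with the spectator
  have hmain : ∫⁻ U, g U * ∏ p ∈ P, w p U ∂(Measure.pi fun _ : Edge 3 L => haarProbability G) ≤
      ENNReal.ofReal (z) ^ P.card *
        ∫⁻ U, g U ∂(Measure.pi fun _ : Edge 3 L => haarProbability G) := by
    refine lintegral_mul_prod_le_pow_mul_lintegral (haarProbability G) P links top rk hrk htop
      (fun p hp => (hP p hp).1.1) (fun p hp => (hP p hp).1.2) w
      (fun p _ => TorusGauge.TorusUpper.measurable_weight ρ hρc (b / 4) p) (fun p _ U => hw1 p U)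
      (fun p _ U V hUV => ?_) _ (fun p hp U => ?_) g hgm
      {e : Edge 3 L | ∀ ν : Fin 3, ν ≠ e.2 → e.1 ν = 0} (fun U V hUV => ?_) (fun p hp hmem => ?_)
    · -- the weight of `p` depends only on the four links of `p`
      show ENNReal.ofReal _ = ENNReal.ofReal _
      rw [TorusUpperD3.plaquetteHolonomy_eq_of_eqOn p fun e he => hUV e (Finset.mem_coe.2 he)]
    · -- integrating out the top link of `p` gives the one-link Laplace integral at `b/4 ≥ 1`
      show ∫⁻ x, ENNReal.ofReal (Real.exp (-(b / 4 * ((N : ℝ) -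
          (ρ (plaquetteHolonomy (Function.update U (top p) x) p.1 p.2.1.1 p.2.1.2)).trace.re))))
          ∂haarProbability G ≤ _
      rw [TorusUpperD3.lintegral_update_plaquetteHolonomy
          (TorusGauge.TorusUpper.measurable_ofReal_boltzmann ρ hρc (b / 4)) hL U p (hP p hp).1.1,
        TorusGauge.TorusUpper.lintegral_ofReal_boltzmann ρ hρc (b / 4)]
      exact ENNReal.ofReal_le_ofReal hlap
    · -- the spectator reads only axis links
      show ENNReal.ofReal (Real.exp (-t * wilsonAction ρ (Ψ U))) =
        ENNReal.ofReal (Real.exp (-t * wilsonAction ρ (Ψ V)))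
      have hΨ : Ψ U = Ψ V := funext fun e' => lineHolonomy_zero_congr_axis_d3 e'.2 L fun e he => hUV e he
      rw [hΨ]
    · -- no top link is an axis link
      obtain ⟨ν, hν, hne⟩ := (hP p hp).2
      exact hne (hmem ν hν)
  -- (3) the spectator integrates to the one-site partition function
  have hspec : ∫⁻ U, g U ∂(Measure.pi fun _ : Edge 3 L => haarProbability G) =
      partitionFunction (d := 3) (L := 1) ρ t := by
    show ∫⁻ U, ENNReal.ofReal (Real.exp (-t * wilsonAction ρ (Ψ U))) ∂_ = _
    rw [OneSiteD3.partitionFunction_eq_lintegral', ← map_axisHolonomy_pi_haar_d3 (G := G) L hL,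
      lintegral_map hEm hΨm]
  have hcardP : P.card = 2 * L ^ 3 - 2 := by omega
  have hZ : partitionFunction (d := 3) (L := L) ρ (b / 2) ≤
      ENNReal.ofReal (z) ^ P.card *
        partitionFunction (d := 3) (L := 1) ρ t := by
    rw [OneSiteD3.partitionFunction_eq_lintegral' ρ (b / 2), ← hspec]
    exact (lintegral_mono fun U => hpt U).trans hmain
  have hZ1pos := partitionFunction_toReal_pos (d := 3) (L := 1) ρ hρc t
  have hZ1top : partitionFunction (d := 3) (L := 1) ρ t ≠ ⊤ := (ENNReal.toReal_pos_iff.1 hZ1pos).2.ne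
  have htop : ENNReal.ofReal (z) ^ P.card *
      partitionFunction (d := 3) (L := 1) ρ t ≠ ⊤ :=
    ENNReal.mul_ne_top (ENNReal.pow_ne_top ENNReal.ofReal_ne_top) hZ1top
  calc (partitionFunction (d := 3) (L := L) ρ (b / 2)).toReal
      ≤ (ENNReal.ofReal (z) ^ P.card *
          partitionFunction (d := 3) (L := 1) ρ t).toReal := ENNReal.toReal_mono htop hZ
    _ = (z) ^ (2 * L ^ 3 - 2) *
          (partitionFunction (d := 3) (L := 1) ρ t).toReal := by
        rw [ENNReal.toReal_mul, ENNReal.toReal_pow, ENNReal.toReal_ofReal hz0, hcardP]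

/-- **The `SU(2)` conditioned upper bound with the sharp one-link exponent**: on `(ℤ∕L)³`, `L ≥ 2`, `b ≥ 4`, `ρ = fundamentalRep (Fin 2)`:
`Z_L(b∕2) ≤ (8∕((b∕4)√(b∕4)))^{2L³−2} · Z₁(b∕(4L²))` (✓`integral_exp_neg_mul_actionTerm_fundamentalRep_le` at `β′ = b∕4 ≥ 1`). [folklore] -/
theorem torus_upper_axisHolonomy_su2_d3 (L : ℕ) [NeZero L] {b : ℝ} (hL : 2 ≤ L) (hb : 4 ≤ b) :
    (partitionFunction (d := 3) (L := L) (fundamentalRep (Fin 2)) (b / 2)).toReal ≤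
      (8 / ((b / 4) * Real.sqrt (b / 4))) ^ (2 * L ^ 3 - 2) *
        (partitionFunction (d := 3) (L := 1) (fundamentalRep (Fin 2)) (b / (4 * (L : ℝ) ^ 2))).toReal := by
  haveI := Literature.Barriers.QuantumFields.secondCountableTopology_su 2
  have hb4 : 1 ≤ b / 4 := by linarith
  refine torus_upper_axisHolonomy_d3_of_oneLink (fundamentalRep (Fin 2)) (continuous_fundamentalRep (Fin 2))
    fundamentalRep_mem_unitaryGroup L hL (by linarith) (by positivity) ?_
  have h := OneLinkGaussianSU2.integral_exp_neg_mul_actionTerm_fundamentalRep_le hb4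
  simp only [neg_mul] at h
  exact h

/-- **Reindexing the one-site integral**: `∫⁻_{Fin 3 → G} e^{−s·S_W(a ∘ pr₂)} dHaar^{⊗3} = Z₁(s)` on `(ℤ∕1)³` — the map `a ↦ (e ↦ a e.2)` pushes
`Haar^{⊗ Fin 3}` to `Haar^{⊗ Edge 3 1}` (`Edge 3 1 → Fin 3`, `e ↦ e.2` is injective, the site factor being a singleton). [folklore] -/
theorem lintegral_oneSite_eq_partitionFunction {G : Type} [Group G] [TopologicalSpace G] [IsTopologicalGroup G]
    [CompactSpace G] [MeasurableSpace G] [BorelSpace G] {N : ℕ}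
    (ρ : G →* Matrix (Fin N) (Fin N) ℂ) (hρc : Continuous ρ) (s : ℝ) :
    ∫⁻ a : Fin 3 → G, ENNReal.ofReal (Real.exp (-s * wilsonAction ρ (fun e : Edge 3 1 => a e.2)))
        ∂(Measure.pi fun _ : Fin 3 => haarProbability G) =
      partitionFunction (d := 3) (L := 1) ρ s := by
  have hj : Function.Injective (fun e : Edge 3 1 => e.2) := fun e₁ e₂ h =>
    Prod.ext (Subsingleton.elim _ _) h
  have hEm : Measurable fun V : GaugeConfig 3 1 G =>
      ENNReal.ofReal (Real.exp (-s * wilsonAction ρ V)) :=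
    ENNReal.measurable_ofReal.comp (Real.measurable_exp.comp
      ((WilsonRP.measurable_wilsonAction ρ hρc).const_mul _))
  have hmeas : Measurable fun (a : Fin 3 → G) (e : Edge 3 1) => a e.2 :=
    measurable_pi_lambda _ fun e => measurable_pi_apply e.2
  rw [OneSiteD3.partitionFunction_eq_lintegral', ← pi_map_proj_eq_pi (haarProbability G) hj,
    lintegral_map hEm hmeas]

/-- `Z(β)` on `(ℤ∕L)³` is antitone in the coupling (`S ≥ 0`). [folklore] -/
theorem partitionFunction_antitone_d3 {G : Type} [Group G] [TopologicalSpace G] [IsTopologicalGroup G]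
    [CompactSpace G] [MeasurableSpace G] [BorelSpace G] [SecondCountableTopology G] {N : ℕ}
    (ρ : G →* Matrix (Fin N) (Fin N) ℂ) (hρc : Continuous ρ) {L : ℕ} [NeZero L] {β β' : ℝ} (h : β ≤ β') :
    (partitionFunction (d := 3) (L := L) ρ β').toReal ≤ (partitionFunction (d := 3) (L := L) ρ β).toReal := by
  have hZpos := partitionFunction_toReal_pos (d := 3) (L := L) ρ hρc β
  have hZtop : partitionFunction (d := 3) (L := L) ρ β ≠ ⊤ := (ENNReal.toReal_pos_iff.1 hZpos).2.ne
  refine ENNReal.toReal_mono hZtop ?_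
  rw [OneSiteD3.partitionFunction_eq_lintegral', OneSiteD3.partitionFunction_eq_lintegral']
  refine lintegral_mono fun U => ENNReal.ofReal_le_ofReal (Real.exp_le_exp.2 ?_)
  have hS : 0 ≤ wilsonAction ρ U :=
    Finset.sum_nonneg fun p _ => sub_nonneg.2 (re_trace_le ρ hρc _)
  nlinarith

/-- **Iterated one-site doubling** on `(ℤ∕1)³`: if `Z₁(t∕4) ≤ K Z₁(t)` for all `t > 0` (`K ≥ 0`), then `Z₁(t∕4^m) ≤ K^m Z₁(t)`. [folklore] -/
theorem partitionFunction_iterate_quarter_d3 {G : Type} [Group G] [TopologicalSpace G] [IsTopologicalGroup G]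
    [CompactSpace G] [MeasurableSpace G] [BorelSpace G] {N : ℕ}
    (ρ : G →* Matrix (Fin N) (Fin N) ℂ) {K : ℝ} (hK : 0 ≤ K)
    (hdbl : ∀ t : ℝ, 0 < t → (partitionFunction (d := 3) (L := 1) ρ (t / 4)).toReal ≤
      K * (partitionFunction (d := 3) (L := 1) ρ t).toReal) :
    ∀ (m : ℕ) (t : ℝ), 0 < t → (partitionFunction (d := 3) (L := 1) ρ (t / 4 ^ m)).toReal ≤
      K ^ m * (partitionFunction (d := 3) (L := 1) ρ t).toReal := by
  intro m
  induction m with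
  | zero => intro t _; simp
  | succ m ih =>
    intro t ht
    have h4m : (0 : ℝ) < 4 ^ m := pow_pos (by norm_num) m
    have hstep := hdbl (t / 4 ^ m) (div_pos ht h4m)
    rw [div_div, ← pow_succ] at hstep
    calc (partitionFunction (d := 3) (L := 1) ρ (t / 4 ^ (m + 1))).toReal
        ≤ K * (partitionFunction (d := 3) (L := 1) ρ (t / 4 ^ m)).toReal := hstep
      _ ≤ K * (K ^ m * (partitionFunction (d := 3) (L := 1) ρ t).toReal) :=
          mul_le_mul_of_nonneg_left (ih t ht) hK
      _ = K ^ (m + 1) * (partitionFunction (d := 3) (L := 1) ρ t).toReal := by ring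

/-- The temperature mismatch of the conditioned sandwich on `(ℤ∕L)³` is a power of `4`: `16 L³ ≤ 4^{3L+2}`. -/
theorem sixteen_mul_pow_three_le (L : ℕ) : (16 * (L : ℝ) ^ 3) ≤ (4 : ℝ) ^ (3 * L + 2) := by
  have h1 : L ^ 3 ≤ (2 ^ L) ^ 3 := Nat.pow_le_pow_left L.lt_two_pow_self.le 3
  have h1' : (2 ^ L) ^ 3 ≤ (4 ^ L) ^ 3 := Nat.pow_le_pow_left (Nat.pow_le_pow_left (by norm_num) L) 3
  have h2 : (16 * L ^ 3 : ℕ) ≤ 4 ^ (3 * L + 2) := by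
    calc 16 * L ^ 3 ≤ 16 * (4 ^ L) ^ 3 := Nat.mul_le_mul_left 16 (h1.trans h1')
      _ = 4 ^ (3 * L + 2) := by rw [pow_add, pow_mul']; norm_num; ring
  exact_mod_cast h2

/-- Per-link uniformity: `(√(1+b))³ ≤ 32 · ((b∕4)√(b∕4))` for `b ≥ 4` — no power of `b` survives the sandwich. -/
theorem sqrt_one_add_pow_three_le {b : ℝ} (hb : 4 ≤ b) :
    Real.sqrt (1 + b) ^ 3 ≤ 32 * ((b / 4) * Real.sqrt (b / 4)) := by
  have hu0 : 0 ≤ b / 4 := by linarith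
  have h3 : (3 : ℝ) = Real.sqrt 9 := by
    rw [show (9 : ℝ) = 3 ^ 2 by norm_num, Real.sqrt_sq (by norm_num)]
  have h1 : Real.sqrt (1 + b) ≤ 3 * Real.sqrt (b / 4) := by
    rw [h3, ← Real.sqrt_mul (by norm_num)]
    exact Real.sqrt_le_sqrt (by linarith)
  have hs0 : 0 ≤ Real.sqrt (1 + b) := Real.sqrt_nonneg _
  have hsu : Real.sqrt (b / 4) ^ 2 = b / 4 := Real.sq_sqrt hu0
  calc Real.sqrt (1 + b) ^ 3 ≤ (3 * Real.sqrt (b / 4)) ^ 3 := pow_le_pow_left₀ hs0 h1 3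
    _ = 27 * ((b / 4) * Real.sqrt (b / 4)) := by
        have h3' : Real.sqrt (b / 4) ^ 3 = (b / 4) * Real.sqrt (b / 4) := by rw [pow_succ, hsu]
        rw [mul_pow, h3']
        norm_num
    _ ≤ 32 * ((b / 4) * Real.sqrt (b / 4)) := by nlinarith [Real.sqrt_nonneg (b / 4)]

/-- **UNIFORM DOUBLING OF THE `SU(2)` WILSON PARTITION FUNCTION ON `(ℤ∕L)³`, MODULO THE ONE-SITE DOUBLING.**  If the one-site
(three-link commutator) partition function doubles, `Z₁(t∕4) ≤ K·Z₁(t)` for all `t > 0`, then there is `A` with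
`Z_L(b∕2) ≤ e^{A·L³} · Z_L(b)` for all `L ≥ 2`, `b ≥ 4` — a doubling constant per unit volume that is UNIFORM in the coupling `b`.
Assembly: T4-UP `torus_upper_axisHolonomy_su2_d3` (at `b`, giving `Z₁(b∕(4L²))`), T4-LOW ✓`exists_lintegral_boltzmann_ge_axisHolonomy_SU` (★w7, at `b`,
giving `Z₁(4Lb)`), antitonicity and `3L + 2` iterations of `hONE` across the mismatch `16L³ ≤ 4^{3L+2}`, and the per-link uniformity
`sqrt_one_add_pow_three_le`; `A = 288 + 2·log(256∕c) + 5·log(max 1 K)`. [cite: arXiv160201222, §11] -/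
theorem uniformDoubling_su2_d3_of_oneSiteDoubling
    (hONE : ∃ K : ℝ, ∀ t : ℝ, 0 < t →
      (partitionFunction (d := 3) (L := 1) (fundamentalRep (Fin 2)) (t / 4)).toReal ≤
        K * (partitionFunction (d := 3) (L := 1) (fundamentalRep (Fin 2)) t).toReal) :
    ∃ A : ℝ, ∀ (L : ℕ) [NeZero L] (b : ℝ), 2 ≤ L → 4 ≤ b →
      (partitionFunction (d := 3) (L := L) (fundamentalRep (Fin 2)) (b / 2)).toReal ≤
        Real.exp (A * (L : ℝ) ^ 3) * (partitionFunction (d := 3) (L := L) (fundamentalRep (Fin 2)) b).toReal := by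
  haveI := Literature.Barriers.QuantumFields.secondCountableTopology_su 2
  obtain ⟨K, hK⟩ := hONE
  obtain ⟨c, hc, hc1, hlow⟩ :=
    TorusTreeGauge.exists_lintegral_boltzmann_ge_axisHolonomy_SU (d := 3) (N := 2)
  have hρc := continuous_fundamentalRep (Fin 2)
  -- `K > 0` (the one-site partition function is positive)
  have hK0 : 0 < K := by
    have h1 := hK 1 one_pos
    exact (mul_pos_iff_of_pos_right (partitionFunction_toReal_pos (d := 3) (L := 1) _ hρc (1 : ℝ))).1
      ((partitionFunction_toReal_pos (d := 3) (L := 1) (fundamentalRep (Fin 2)) hρc ((1 : ℝ) / 4)).trans_le h1)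
  have hiter := partitionFunction_iterate_quarter_d3 (fundamentalRep (Fin 2)) hK0.le hK
  refine ⟨288 + 2 * Real.log (256 / c) + 5 * Real.log (max 1 K), fun L _ b hL hb => ?_⟩
  haveI : Fact (1 < L) := ⟨by omega⟩
  have hL0 : (0 : ℝ) < L := by exact_mod_cast (show 0 < L by omega)
  have hb0 : 0 ≤ b := by linarith
  set ZLh := (partitionFunction (d := 3) (L := L) (fundamentalRep (Fin 2)) (b / 2)).toReal with hZLh
  set ZL := (partitionFunction (d := 3) (L := L) (fundamentalRep (Fin 2)) b).toReal with hZL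
  set Z1u := (partitionFunction (d := 3) (L := 1) (fundamentalRep (Fin 2)) (b / (4 * (L : ℝ) ^ 2))).toReal with hZ1u
  set Z1l := (partitionFunction (d := 3) (L := 1) (fundamentalRep (Fin 2)) (4 * (L : ℝ) * b)).toReal with hZ1l
  set zup : ℝ := 8 / ((b / 4) * Real.sqrt (b / 4)) with hzup
  set q : ℝ := c * (Real.sqrt (1 + b))⁻¹ ^ 3 with hq
  set M : ℕ := 2 * L ^ 3 - 2 with hM
  set k : ℕ := 3 * L + 2 with hk
  have hZLpos : 0 < ZL := partitionFunction_toReal_pos (d := 3) (L := L) (fundamentalRep (Fin 2)) hρc b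
  have hzup0 : 0 < zup := by positivity
  have hq0 : 0 < q := by positivity
  have hup : ZLh ≤ zup ^ M * Z1u := torus_upper_axisHolonomy_su2_d3 L hL hb
  -- (ONE), iterated across the temperature mismatch `4Lb / 4^k ≤ b/(4L²)`
  have hmis : 4 * (L : ℝ) * b / 4 ^ k ≤ b / (4 * (L : ℝ) ^ 2) := by
    have h16 := sixteen_mul_pow_three_le L
    rw [div_le_div_iff₀ (by positivity) (by positivity)]
    calc 4 * (L : ℝ) * b * (4 * (L : ℝ) ^ 2) = (16 * (L : ℝ) ^ 3) * b := by ring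
      _ ≤ 4 ^ (3 * L + 2) * b := mul_le_mul_of_nonneg_right h16 hb0
      _ = b * 4 ^ k := by rw [hk]; ring
  have hone : Z1u ≤ K ^ k * Z1l :=
    (partitionFunction_antitone_d3 (fundamentalRep (Fin 2)) hρc hmis).trans (hiter k _ (by positivity))
  -- (LOW), in real letters: `e^{-288 L³} q^M Z₁(4Lb) ≤ Z_L(b)`
  have hlowE := hlow L b hb0
  rw [lintegral_oneSite_eq_partitionFunction (fundamentalRep (Fin 2)) hρc,
    ← OneSiteD3.partitionFunction_eq_lintegral'] at hlowE
  have hZLtop : partitionFunction (d := 3) (L := L) (fundamentalRep (Fin 2)) b ≠ ⊤ :=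
    (ENNReal.toReal_pos_iff.1 hZLpos).2.ne
  have hlowR : Real.exp (-(288 * (L : ℝ) ^ 3)) * q ^ M * Z1l ≤ ZL := by
    have h := ENNReal.toReal_mono hZLtop hlowE
    rw [ENNReal.toReal_mul, ENNReal.toReal_mul, ENNReal.toReal_ofReal (Real.exp_pos _).le,
      ENNReal.toReal_ofReal (by positivity)] at h
    have e1 : (16 * ((2 : ℕ) : ℝ) * ((3 : ℕ) : ℝ) ^ 2 * (L : ℝ) ^ 3) = 288 * (L : ℝ) ^ 3 := by
      push_cast; ring
    have e2 : (2 ^ 2 - 1 : ℕ) = 3 := by norm_num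
    have e3 : ((3 - 1) * L ^ 3 + 1 - 3 : ℕ) = M := by rw [hM]; omega
    have e32 : (3 - 2 : ℕ) = 1 := by norm_num
    have e4 : (2 * ((2 : ℕ) : ℝ) * (L : ℝ) ^ (3 - 2) * b) = 4 * (L : ℝ) * b := by
      rw [e32, pow_one]; push_cast; ring
    have hlhs : Real.exp (-(288 * (L : ℝ) ^ 3)) * q ^ M * Z1l =
        Real.exp (-(16 * ((2 : ℕ) : ℝ) * ((3 : ℕ) : ℝ) ^ 2 * (L : ℝ) ^ 3)) *
          (c * (Real.sqrt (1 + b))⁻¹ ^ (2 ^ 2 - 1)) ^ ((3 - 1) * L ^ 3 + 1 - 3) *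
          (partitionFunction (d := 3) (L := 1) (fundamentalRep (Fin 2))
            (2 * ((2 : ℕ) : ℝ) * (L : ℝ) ^ (3 - 2) * b)).toReal := by
      rw [e1, e2, e3, e4]
    rw [hlhs]
    exact h
  -- the per-link ratio is uniform in `b`
  have hratio : zup / q ≤ 256 / c := by
    have h32 := sqrt_one_add_pow_three_le hb
    rw [div_le_div_iff₀ hq0 hc]
    have hq' : q = c / Real.sqrt (1 + b) ^ 3 := by rw [hq, inv_pow]; ring
    have hzup' : zup * c = 8 * c / ((b / 4) * Real.sqrt (b / 4)) := by rw [hzup]; ring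
    rw [hzup', hq', show 256 * (c / Real.sqrt (1 + b) ^ 3) = 256 * c / Real.sqrt (1 + b) ^ 3 by ring,
      div_le_div_iff₀ (by positivity) (by positivity)]
    have h := mul_le_mul_of_nonneg_left h32 (by positivity : (0 : ℝ) ≤ 8 * c)
    linarith
  have h256c : 1 ≤ 256 / c := by
    rw [le_div_iff₀ hc]; linarith
  have hM2 : M ≤ 2 * L ^ 3 := by omega
  have hk5 : k ≤ 5 * L ^ 3 := by
    have : L ≤ L ^ 3 := Nat.le_self_pow (by norm_num) L
    omega
  have hconst : zup ^ M * K ^ k / (Real.exp (-(288 * (L : ℝ) ^ 3)) * q ^ M) ≤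
      Real.exp ((288 + 2 * Real.log (256 / c) + 5 * Real.log (max 1 K)) * (L : ℝ) ^ 3) := by
    have hre : zup ^ M * K ^ k / (Real.exp (-(288 * (L : ℝ) ^ 3)) * q ^ M) =
        (zup / q) ^ M * K ^ k * Real.exp (288 * (L : ℝ) ^ 3) := by
      have hE : Real.exp (-(288 * (L : ℝ) ^ 3)) * Real.exp (288 * (L : ℝ) ^ 3) = 1 := by
        rw [← Real.exp_add, neg_add_cancel, Real.exp_zero]
      have hqM : q ^ M ≠ 0 := pow_ne_zero _ hq0.ne'
      rw [div_eq_iff (mul_ne_zero (Real.exp_pos _).ne' hqM)]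
      calc zup ^ M * K ^ k = (zup / q * q) ^ M * K ^ k *
            (Real.exp (-(288 * (L : ℝ) ^ 3)) * Real.exp (288 * (L : ℝ) ^ 3)) := by
              rw [div_mul_cancel₀ zup hq0.ne', hE, mul_one]
        _ = (zup / q) ^ M * K ^ k * Real.exp (288 * (L : ℝ) ^ 3) *
            (Real.exp (-(288 * (L : ℝ) ^ 3)) * q ^ M) := by
              rw [mul_pow]; ring
    rw [hre]
    have hA : (zup / q) ^ M ≤ (256 / c) ^ (2 * L ^ 3) :=
      (pow_le_pow_left₀ (by positivity) hratio M).trans (pow_le_pow_right₀ h256c hM2)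
    have hB : K ^ k ≤ (max 1 K) ^ (5 * L ^ 3) :=
      (pow_le_pow_left₀ hK0.le (le_max_right 1 K) k).trans (pow_le_pow_right₀ (le_max_left 1 K) hk5)
    have hmax0 : 0 < max 1 K := one_pos.trans_le (le_max_left 1 K)
    have hp1 : (256 / c) ^ (2 * L ^ 3) = Real.exp (Real.log (256 / c) * ((2 * L ^ 3 : ℕ) : ℝ)) := by
      rw [← Real.rpow_natCast, Real.rpow_def_of_pos (by positivity)]
    have hp2 : (max 1 K) ^ (5 * L ^ 3) = Real.exp (Real.log (max 1 K) * ((5 * L ^ 3 : ℕ) : ℝ)) := by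
      rw [← Real.rpow_natCast, Real.rpow_def_of_pos hmax0]
    calc (zup / q) ^ M * K ^ k * Real.exp (288 * (L : ℝ) ^ 3)
        ≤ (256 / c) ^ (2 * L ^ 3) * (max 1 K) ^ (5 * L ^ 3) * Real.exp (288 * (L : ℝ) ^ 3) :=
          mul_le_mul_of_nonneg_right (mul_le_mul hA hB (by positivity) (by positivity)) (Real.exp_pos _).le
      _ = Real.exp ((288 + 2 * Real.log (256 / c) + 5 * Real.log (max 1 K)) * (L : ℝ) ^ 3) := by
          rw [hp1, hp2, ← Real.exp_add, ← Real.exp_add]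
          congr 1
          push_cast
          ring
  have hEq0 : 0 < Real.exp (-(288 * (L : ℝ) ^ 3)) * q ^ M := by positivity
  have hZ1l_le : Z1l ≤ ZL / (Real.exp (-(288 * (L : ℝ) ^ 3)) * q ^ M) := by
    rw [le_div_iff₀ hEq0]
    linarith [hlowR]
  calc ZLh ≤ zup ^ M * Z1u := hup
    _ ≤ zup ^ M * (K ^ k * Z1l) := mul_le_mul_of_nonneg_left hone (by positivity)
    _ ≤ zup ^ M * (K ^ k * (ZL / (Real.exp (-(288 * (L : ℝ) ^ 3)) * q ^ M))) :=
        mul_le_mul_of_nonneg_left (mul_le_mul_of_nonneg_left hZ1l_le (by positivity)) (by positivity)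
    _ = zup ^ M * K ^ k / (Real.exp (-(288 * (L : ℝ) ^ 3)) * q ^ M) * ZL := by ring
    _ ≤ Real.exp ((288 + 2 * Real.log (256 / c) + 5 * Real.log (max 1 K)) * (L : ℝ) ^ 3) * ZL :=
        mul_le_mul_of_nonneg_right hconst hZLpos.le

end Summit.QuantumFields.YangMills.Theorems.LocalInsertion.TorusUniformDoublingSU2D3

end
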